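import Summits.Ventures.YMGap.RobustBall.DobrushinPairwise
import Summits.Ventures.YMGap.RobustBall.ZdAxisProfile
import Summits.Ventures.YMGap.RobustBall.RobustMassGapDoor
import HarnessLib

/-!
# Robust ball (Y2) — `ℓ∞`-SEPARATION CLUSTERING ON `ℤ^d` AT THE AXIS RATE from a split Dobrushin matrix
# (pairwise Föllmer estimate + two-sided axis profiles): the column inequality and the generic bound

HONEST FRAMING: venture file of the cell `pub-ymgap` (QuantumFields programme), track ROBUST-BALL, seat rb-p2 (g11).  Generic strong-coupling LATTICE
bookkeeping for a specification of `SU(N)` link variables on `ℤ^d` under Dobrushin's condition in the Vasserstein form (`IsKRContraction`); no coupling,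
no member, no number here (those are in the sibling `ZdPairwiseClustering`); the rate is a Dobrushin-comparison floor, not a computation of a mass gap;
nothing continuum / spectral / Clay.

WHAT IS NEW (the `ℤ^d` twin of `TorusAxisColumn` / `TorusAxisClustering`).  The axis files `ZdAxisClustering(Ball)` reach the single-entry rate `θ = φ²` per
lattice unit only for supports separated ALONG ONE AXIS (half-line profile, one profile for the whole target set).  Here a split Dobrushin matrix
`C(e,y) ≤ A·linkInfluence e y + L(e,y)` (`A, L ≥ 0`, rows of `L` `≤ Λ`, `ℓ∞`-range `R`) is run through Föllmer's PAIRWISE estimate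
(`DobrushinPairwise.abs_covariance_le_of_pair_profile`) with, for every target link `y`, the column `p(x,y) = min_i θ^{|H_i x − H_i y|}` built from the
TWO-SIDED profile `θ^{|k|}` on `ℤ` in the doubled midpoint coordinates `H_i(x, μ) = 2x_i + [μ = i]`:
* `pow_natAbs_twoSided` — `θ^{|k+1|} + θ^{|k−1|} ≤ (θ+θ⁻¹)θ^{|k|}` on all of `ℤ` (eigenvector off `0`, subsolution at `0` because `θ ≤ θ⁻¹`);
* `abs_covariance_le_pairwise_of_target` — generic Lyapunov form of `DobrushinPairwise.abs_covariance_le_pairwise` with the margin `s₀ < 1` required AT THE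
  TARGET only (`Σ_z C(y,z)p(z,y) ≤ s₀ p(y,y)`; margin-free off the target): constant `R²/(1−s₀)` (used by the sharp forms `ZdPairwiseSharp`, `TorusAxisSharp`);
* `column_le_of_split` — each `θ^{|H_i · − t|}` is a column supersolution with margin `s` as soon as
  `A·P(θ) + Λ θ⁻¹^{2R+1} ≤ s`, `P(θ) = max(2(d−1)(θ+θ⁻¹+1), θ⁻²+2θ⁻¹+2θ+θ²+6(d−2))` — the exact staple-offset multisets of
  `ZdAxisProfile.sum_linkInfluence_mul_le_axis`, used with the position-dependent weight `c(D) = θ^{|h+D|}/θ^{|h|}`; `row_le_of_split` — the plain row is `≤ s` too;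
* `abs_cov_le_linfty_of_split` — GENERIC: for `0 < θ ≤ 1`, `s < 1` and that one condition, every Gibbs measure and ALL bounded measurable local `f, g` whose
  supports are at `ℓ∞`-distance `≥ n` (every pair of base points; `forall_le_norm_of_le_setDistEdges` converts the tree's `setDistEdges`) satisfy
  `|cov_μ(f,g)| ≤ (4N/(θ(1−s))) (Σδ_g)(Σδ_f) θ^{2n}` — the `ClustersWith` shape of the torus files, on `ℤ^d`, for ARBITRARY supports, rate `2 log θ⁻¹` per
  lattice unit (the minimum over axes of column supersolutions is one; a pair at `ℓ∞`-distance `n` is `≥ 2n−1` apart in the doubled coordinate of the axis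
  realising the distance).

## References
* H. Föllmer, LNM 1362 (1988), Ch. I, Thm. (2.13), Remark (2.17); H. Künsch, CMP 84 (1982) 207, Thm. 2.1; R. L. Dobrushin, Theory Probab. Appl. 15 (1970) 458.
* The tree: `DobrushinPairwise`, `ZdAxisProfile`, `TorusAxisProfile` / `TorusAxisCycle` (this seat; the torus twin), `RobustMassGapDoor` (rb-p1; `sum_linkInfluence_le_of_subset`).
-/

noncomputable section

open MeasureTheory ProbabilityTheory Filter Topology Function Finset Real
open scoped NNReal
open Literature.Probability.LatticeModels
open Literature.Probability.LatticeModels.DobrushinMetric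
open Literature.MathematicalPhysics.QuantumLattice
open Literature.MathematicalPhysics.QuantumFieldTheory hiding ZdEdge
open Summit.Ventures.YMGap.RobustBall.DobrushinPairwise

namespace Summit.Ventures.YMGap.RobustBall.ZdAxis

variable {d N : ℕ}

/-! ### The two-sided profile `θ^{|k|}` on `ℤ` -/

/-- Shift bound of the two-sided profile: `θ^{|k+u|} ≤ θ⁻¹^{|u|} θ^{|k|}` for `0 < θ ≤ 1`. [folklore] -/
theorem pow_natAbs_add_le {θ : ℝ} (hθ0 : 0 < θ) (hθ1 : θ ≤ 1) (k u : ℤ) :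
    θ ^ (k + u).natAbs ≤ θ⁻¹ ^ u.natAbs * θ ^ k.natAbs := by
  rw [inv_pow, le_inv_mul_iff₀ (pow_pos hθ0 _), ← pow_add]
  exact pow_le_pow_of_le_one hθ0.le hθ1 (by omega)

/-- The two-sided profile is a `(θ + θ⁻¹)`-eigenvector off the origin and a subsolution at the origin:
`θ^{|k+1|} + θ^{|k−1|} ≤ (θ + θ⁻¹) θ^{|k|}` for all `k ∈ ℤ` (`0 < θ ≤ 1`). [folklore] -/
theorem pow_natAbs_twoSided {θ : ℝ} (hθ0 : 0 < θ) (hθ1 : θ ≤ 1) (k : ℤ) :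
    θ ^ (k + 1).natAbs + θ ^ (k - 1).natAbs ≤ (θ + θ⁻¹) * θ ^ k.natAbs := by
  have hθ := hθ0.ne'
  rcases lt_trichotomy k 0 with hk | rfl | hk
  · have e1 : k.natAbs = (k + 1).natAbs + 1 := by omega
    have e2 : (k - 1).natAbs = (k + 1).natAbs + 2 := by omega
    rw [e1, e2]
    refine le_of_eq ?_
    field_simp
    ring
  · have h : θ ≤ θ⁻¹ := hθ1.trans ((one_le_inv₀ hθ0).2 hθ1)
    simp
    linarith
  · have e1 : k.natAbs = (k - 1).natAbs + 1 := by omega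
    have e2 : (k + 1).natAbs = (k - 1).natAbs + 2 := by omega
    rw [e1, e2]
    refine le_of_eq ?_
    field_simp
    ring

/-- The second-difference form two steps out, for ANY `g` with `g(k+1)+g(k−1) ≤ (θ+θ⁻¹)g(k)` (`θ > 0`):
`g(k+2) + g(k−2) ≤ (θ² + θ⁻²) g(k)`. [folklore] -/
theorem twoStep_of_twoSided {θ : ℝ} (hθ0 : 0 < θ) {g : ℤ → ℝ}
    (hg1 : ∀ k, g (k + 1) + g (k - 1) ≤ (θ + θ⁻¹) * g k) (k : ℤ) :
    g (k + 2) + g (k - 2) ≤ (θ ^ 2 + θ⁻¹ ^ 2) * g k := by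
  have h1 := hg1 (k + 1)
  have h2 := hg1 (k - 1)
  rw [show k + 1 + 1 = k + 2 by ring, show k + 1 - 1 = k by ring] at h1
  rw [show k - 1 + 1 = k by ring, show k - 1 - 1 = k - 2 by ring] at h2
  have h3 := hg1 k
  have hθθ : 0 ≤ θ + θ⁻¹ := by positivity
  have e : (θ ^ 2 + θ⁻¹ ^ 2) * g k = (θ + θ⁻¹) * ((θ + θ⁻¹) * g k) - 2 * g k := by
    have : θ * θ⁻¹ = 1 := mul_inv_cancel₀ hθ0.ne'
    ring_nf; rw [this]; ring
  rw [e]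
  nlinarith [mul_le_mul_of_nonneg_left (add_le_add h1 h2) hθθ]

/-- `θ^{2n−1} ≤ θ⁻¹ (θ²)^n` for `0 < θ ≤ 1` (natural subtraction at `n = 0`). [folklore] -/
theorem pow_two_mul_sub_one_le' {θ : ℝ} (hθ0 : 0 < θ) (hθ1 : θ ≤ 1) (n : ℕ) : θ ^ (2 * n - 1) ≤ θ⁻¹ * (θ ^ 2) ^ n := by
  cases n with
  | zero => simpa using (one_le_inv₀ hθ0).2 hθ1
  | succ m =>
    have e : θ⁻¹ * (θ ^ 2) ^ (m + 1) = θ ^ (2 * m + 1) := by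
      rw [← pow_mul, show 2 * (m + 1) = (2 * m + 1) + 1 by ring, pow_succ]
      field_simp
    rw [e, show 2 * (m + 1) - 1 = 2 * m + 1 by omega]

/-! ### Lattice geometry: doubled coordinates under `ℓ∞` control -/

/-- Links within `ℓ∞`-distance `R` have doubled axis coordinates within `2R + 1` (natural-number form). [folklore] -/
theorem natAbs_axisOffset_le_of_norm_le {e y : ZdEdge d} {R : ℕ} (h : ‖e.1 - y.1‖ ≤ (R : ℝ)) (i : Fin d) :
    ((2 * y.1 i + (if y.2 = i then 1 else 0)) - (2 * e.1 i + (if e.2 = i then 1 else 0)) : ℤ).natAbs ≤ 2 * R + 1 := by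
  have h1 : |y.1 i - e.1 i| ≤ (R : ℤ) := by
    have h2 : ‖(e.1 - y.1) i‖ ≤ (R : ℝ) := (norm_le_pi_norm _ i).trans h
    rw [Pi.sub_apply, Int.norm_eq_abs] at h2
    have h3 : ((|e.1 i - y.1 i| : ℤ) : ℝ) ≤ R := by rw [Int.cast_abs]; exact_mod_cast h2
    rw [abs_sub_comm]
    exact_mod_cast h3
  rw [abs_le] at h1
  split_ifs <;> omega

/-- A lattice vector of `ℓ∞`-norm `≥ n ≥ 1` has a coordinate of modulus `≥ n`. [folklore] -/
theorem exists_le_natAbs_of_le_norm {v : Site d} {n : ℕ} (hn : 1 ≤ n) (h : (n : ℝ) ≤ ‖v‖) : ∃ i, n ≤ (v i).natAbs := by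
  by_contra hcon
  have hlt : ‖v‖ < n := by
    rw [pi_norm_lt_iff (by exact_mod_cast hn)]
    intro i
    have hi : (v i).natAbs < n := lt_of_not_ge fun h' => hcon ⟨i, h'⟩
    rw [Int.norm_eq_abs, ← Int.cast_abs, Int.abs_eq_natAbs]
    exact_mod_cast hi
  linarith

/-- Base points at `ℓ∞`-distance `≥ n` are `≥ 2n − 1` apart in the doubled coordinate of some axis. [folklore] -/
theorem exists_le_natAbs_hc_sub {x y : ZdEdge d} {n : ℕ} (hn : 1 ≤ n) (h : (n : ℝ) ≤ ‖x.1 - y.1‖) :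
    ∃ i : Fin d, 2 * n - 1 ≤ ((2 * x.1 i + (if x.2 = i then 1 else 0)) - (2 * y.1 i + (if y.2 = i then 1 else 0)) : ℤ).natAbs := by
  obtain ⟨i, hi⟩ := exists_le_natAbs_of_le_norm hn h
  refine ⟨i, ?_⟩
  rw [Pi.sub_apply] at hi
  split_ifs <;> omega

/-! ### The pairwise estimate with margin at the target only -/

section Target

variable {V S : Type*} [MeasurableSpace S] {γ : Specification V S} {r : S → S → ℝ} {nbr : V → Finset V} {C : V → V → ℝ}

/-- **Lyapunov form with margin AT THE TARGET ONLY.**  If `p(·,y) ≥ 0`, `p(y,y) > 0`, `Σ_{z ∈ nbr x} C(x,z) p(z,y) ≤ p(x,y)` for all `x ≠ y` and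
`Σ_{z ∈ nbr y} C(y,z) p(z,y) ≤ s₀·p(y,y)` (`y ∈ Δ_g`, `s₀ < 1`), then `|cov_μ(f,g)| ≤ (R²/(1−s₀)) Σ_{x ∈ Δ_f} Σ_{y ∈ Δ_g} δ_f(x) (p(x,y)/p(y,y)) δ_g(y)`
(`u = p/((1−s₀)p(y,y))` is a column supersolution: `1 + s₀/(1−s₀) = 1/(1−s₀)` at the target). [cite: Follmer1988, Ch. I Theorem (2.13)] -/
theorem abs_covariance_le_pairwise_of_target [DecidableEq V] (hγ : IsSpecification γ) (hC : IsKRContraction γ r nbr C) {R : ℝ}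
    (hr0 : ∀ a b, 0 ≤ r a b) (hrR : ∀ a b, r a b ≤ R) (hR : 0 ≤ R) {c : ℝ} (hc0 : 0 ≤ c) (hc1 : c < 1)
    (hrow : ∀ x, ∑ y ∈ nbr x, C x y ≤ c) {μ : Measure (V → S)} (hμ : IsGibbsMeasure γ μ) {f g : (V → S) → ℝ}
    (hfm : Measurable f) {Δf : Finset V} (hfdep : DependsOn f (↑Δf : Set V)) {Mf : ℝ} (hMf : ∀ σ, |f σ| ≤ Mf)
    {δf : V → ℝ} (hδf : IsLipBound r f δf) (hgm : Measurable g) {Δg : Finset V} (hgdep : DependsOn g (↑Δg : Set V))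
    {Mg : ℝ} (hMg : ∀ σ, |g σ| ≤ Mg) {δg : V → ℝ} (hδg : IsLipBound r g δg) {s₀ : ℝ} (hs1 : s₀ < 1)
    {p : V → V → ℝ} (hp0 : ∀ x y, 0 ≤ p x y) (hpy : ∀ y ∈ Δg, 0 < p y y)
    (hp : ∀ y ∈ Δg, ∀ x, x ≠ y → ∑ z ∈ nbr x, C x z * p z y ≤ p x y)
    (hpt : ∀ y ∈ Δg, ∑ z ∈ nbr y, C y z * p z y ≤ s₀ * p y y) :
    |cov[f, g; μ]| ≤ R ^ 2 / (1 - s₀) * ∑ x ∈ Δf, ∑ y ∈ Δg, δf x * (p x y / p y y) * δg y := by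
  have h1s : 0 < 1 - s₀ := by linarith
  set u : V → V → ℝ := fun x y => p x y / ((1 - s₀) * (if y ∈ Δg then p y y else 1)) with hu
  have hden : ∀ y, 0 < (1 - s₀) * (if y ∈ Δg then p y y else 1) := fun y => by
    split_ifs with hy
    · exact mul_pos h1s (hpy y hy)
    · rw [mul_one]; exact h1s
  have hu0 : ∀ x y, 0 ≤ u x y := fun x y => div_nonneg (hp0 x y) (hden y).le
  have hcol : ∀ y ∈ Δg, ∀ x, (if x = y then (1 : ℝ) else 0) + ∑ z ∈ nbr x, C x z * u z y ≤ u x y := by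
    intro y hy x
    simp only [hu, if_pos hy]
    have hq : 0 < (1 - s₀) * p y y := mul_pos h1s (hpy y hy)
    have hS : ∑ z ∈ nbr x, C x z * (p z y / ((1 - s₀) * p y y)) = (∑ z ∈ nbr x, C x z * p z y) / ((1 - s₀) * p y y) := by
      rw [Finset.sum_div]
      exact Finset.sum_congr rfl fun z _ => by rw [mul_div_assoc]
    rw [hS, ← le_sub_iff_add_le, ← sub_div, le_div_iff₀ hq]
    split_ifs with hxy
    · subst hxy
      have hpx := hpt x hy
      linarith
    · rw [zero_mul]
      have hpx := hp y hy x hxy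
      linarith
  refine (abs_covariance_le_pairwise hγ hC hr0 hrR hR hc0 hc1 hrow hμ hfm hfdep hMf hδf hgm hgdep hMg hδg hu0 hcol).trans
    (le_of_eq ?_)
  have e : ∀ x ∈ Δf, ∀ y ∈ Δg, δf x * u x y * δg y = (1 / (1 - s₀)) * (δf x * (p x y / p y y) * δg y) := by
    intro x _ y hy
    have hpy' := (hpy y hy).ne'
    simp only [hu, if_pos hy]
    field_simp
  rw [Finset.sum_congr rfl fun x hx => Finset.sum_congr rfl fun y hy => e x hx y hy]
  simp_rw [← Finset.mul_sum]
  ring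

end Target

/-! ### The column supersolution of a split Dobrushin matrix along one axis -/

/-- **THE COLUMN INEQUALITY (generic split door on `ℤ^d`).**  `d ≥ 2`; a matrix `C` on links with `C(e,y) ≤ A·linkInfluence e y + L(e,y)` on the
neighbourhoods `nbr e` (`A ≥ 0`, `L ≥ 0`, `Σ_{nbr e} L(e,·) ≤ Λ`, `‖e − y‖∞ ≤ R` on `nbr e`); `0 < θ ≤ 1` with
`A·max(2(d−1)(θ+θ⁻¹+1), θ⁻²+2θ⁻¹+2θ+θ²+6(d−2)) + Λ θ⁻¹^{2R+1} ≤ s`.  Then for every link `x`, axis `i` and centre `t ∈ ℤ`: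
`Σ_{z ∈ nbr x} C(x,z) θ^{|H_i z − t|} ≤ s · θ^{|H_i x − t|}`, `H_i(z) = 2z_i + [dir z = i]`. [folklore] -/
theorem column_le_of_split (hd : 2 ≤ d) {nbr : ZdEdge d → Finset (ZdEdge d)} {C : ZdEdge d → ZdEdge d → ℝ} {A Λ : ℝ}
    (hA : 0 ≤ A) {L : ZdEdge d → ZdEdge d → ℝ} (hL0 : ∀ e y, 0 ≤ L e y)
    (hsplit : ∀ e, ∀ y ∈ nbr e, C e y ≤ A * linkInfluence e y + L e y) (hLrow : ∀ e, ∑ y ∈ nbr e, L e y ≤ Λ)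
    {R : ℕ} (hnbr : ∀ e, ∀ y ∈ nbr e, ‖e.1 - y.1‖ ≤ (R : ℝ)) {θ s : ℝ} (hθ0 : 0 < θ) (hθ1 : θ ≤ 1)
    (hsup : A * max (2 * ((d : ℝ) - 1) * (θ + θ⁻¹ + 1)) (θ⁻¹ ^ 2 + 2 * θ⁻¹ + 2 * θ + θ ^ 2 + 6 * ((d : ℝ) - 2)) +
      Λ * θ⁻¹ ^ (2 * R + 1) ≤ s)
    (x : ZdEdge d) (i : Fin d) (t : ℤ) :
    ∑ z ∈ nbr x, C x z * θ ^ ((2 * z.1 i + (if z.2 = i then 1 else 0)) - t).natAbs ≤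
      s * θ ^ ((2 * x.1 i + (if x.2 = i then 1 else 0)) - t).natAbs := by
  classical
  set H : ZdEdge d → ℤ := fun z => 2 * z.1 i + (if z.2 = i then 1 else 0) with hH
  set u : ZdEdge d → ℝ := fun z => θ ^ (H z - t).natAbs with hu
  change ∑ z ∈ nbr x, C x z * u z ≤ s * u x
  have hu0 : ∀ z, 0 ≤ u z := fun z => pow_nonneg hθ0.le _
  have hux : 0 < u x := pow_pos hθ0 _
  set P : ℝ := max (2 * ((d : ℝ) - 1) * (θ + θ⁻¹ + 1)) (θ⁻¹ ^ 2 + 2 * θ⁻¹ + 2 * θ + θ ^ 2 + 6 * ((d : ℝ) - 2)) with hP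
  set T : ℝ := θ⁻¹ ^ (2 * R + 1) with hT
  have hT0 : 0 ≤ T := pow_nonneg (inv_nonneg.2 hθ0.le) _
  have hθi1 : 1 ≤ θ⁻¹ := (one_le_inv₀ hθ0).2 hθ1
  -- Wilson part: `ZdAxisProfile.sum_linkInfluence_mul_le_axis` with the position-dependent weight `c(D) = θ^{|h + D|}/u(x)`
  set h : ℤ := H x - t with hh
  set c : ℤ → ℝ := fun D => θ ^ (h + D).natAbs / u x with hc
  have hc0 : ∀ D, 0 ≤ c D := fun D => div_nonneg (pow_nonneg hθ0.le _) hux.le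
  have hratio : ∀ w : ZdEdge d,
      u w ≤ c (2 * (w.1 i - x.1 i) + (if w.2 = i then 1 else 0) - (if x.2 = i then 1 else 0)) * u x := by
    intro w
    have e : h + (2 * (w.1 i - x.1 i) + (if w.2 = i then 1 else 0) - (if x.2 = i then 1 else 0)) = H w - t := by
      simp only [hh, hH]; ring
    simp only [hc]
    rw [div_mul_cancel₀ _ hux.ne', e]
  have keyW := sum_linkInfluence_mul_le_axis hd c hc0 x i hu0 hratio (nbr x)
  have hcz : c 0 = 1 := by simp only [hc, add_zero]; exact div_self hux.ne'
  have hux' : u x = θ ^ h.natAbs := rfl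
  have hc1 : c 1 + c (-1) ≤ θ + θ⁻¹ := by
    simp only [hc]
    rw [← add_div, div_le_iff₀ hux, hux', ← sub_eq_add_neg]
    exact pow_natAbs_twoSided hθ0 hθ1 h
  have hc2 : c 2 + c (-2) ≤ θ ^ 2 + θ⁻¹ ^ 2 := by
    simp only [hc]
    rw [← add_div, div_le_iff₀ hux, hux', ← sub_eq_add_neg]
    exact twoStep_of_twoSided hθ0 (g := fun k => θ ^ k.natAbs) (fun k => pow_natAbs_twoSided hθ0 hθ1 k) h
  have hPi : (if x.2 = i then 2 * ((d - 1 : ℕ) : ℝ) * (c 1 + c 0 + c (-1))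
      else c 2 + 2 * c 1 + 2 * c (-1) + c (-2) + 6 * ((d - 2 : ℕ) : ℝ) * c 0) ≤ P := by
    have hd1 : ((d - 1 : ℕ) : ℝ) = (d : ℝ) - 1 := by rw [Nat.cast_sub (by omega)]; simp
    have hd2 : ((d - 2 : ℕ) : ℝ) = (d : ℝ) - 2 := by rw [Nat.cast_sub hd]; simp
    have hd2' : (2 : ℝ) ≤ d := by exact_mod_cast hd
    split_ifs
    · rw [hd1, hcz]
      refine le_trans ?_ (le_max_left _ _)
      have h3 : c 1 + 1 + c (-1) ≤ θ + θ⁻¹ + 1 := by linarith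
      exact mul_le_mul_of_nonneg_left h3 (by linarith)
    · rw [hd2, hcz]
      refine le_trans ?_ (le_max_right _ _)
      linarith
  have hP0 : 0 ≤ P := le_max_of_le_left (mul_nonneg (mul_nonneg zero_le_two (by
    have : (2 : ℝ) ≤ d := by exact_mod_cast hd
    linarith)) (by positivity))
  -- load part: every neighbour is within `ℓ∞`-distance `R`, so its doubled coordinate differs by `≤ 2R+1`
  have hcross : ∀ z ∈ nbr x, u z ≤ T * u x := by
    intro z hz
    have hoff := natAbs_axisOffset_le_of_norm_le (hnbr x z hz) i
    have e : H z - t = (H x - t) + (H z - H x) := by ring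
    simp only [hu]
    rw [e]
    refine (pow_natAbs_add_le hθ0 hθ1 _ _).trans (mul_le_mul_of_nonneg_right ?_ (pow_nonneg hθ0.le _))
    exact pow_le_pow_right₀ hθi1 hoff
  have keyL : ∑ z ∈ nbr x, L x z * u z ≤ Λ * (T * u x) := by
    calc ∑ z ∈ nbr x, L x z * u z ≤ ∑ z ∈ nbr x, L x z * (T * u x) :=
          Finset.sum_le_sum fun z hz => mul_le_mul_of_nonneg_left (hcross z hz) (hL0 x z)
      _ = (∑ z ∈ nbr x, L x z) * (T * u x) := (Finset.sum_mul _ _ _).symm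
      _ ≤ Λ * (T * u x) := mul_le_mul_of_nonneg_right (hLrow x) (mul_nonneg hT0 hux.le)
  calc ∑ z ∈ nbr x, C x z * u z ≤ ∑ z ∈ nbr x, (A * linkInfluence x z + L x z) * u z :=
        Finset.sum_le_sum fun z hz => mul_le_mul_of_nonneg_right (hsplit x z hz) (hu0 z)
    _ = A * ∑ z ∈ nbr x, (linkInfluence x z : ℝ) * u z + ∑ z ∈ nbr x, L x z * u z := by
        rw [Finset.mul_sum, ← Finset.sum_add_distrib]; exact Finset.sum_congr rfl fun z _ => by ring
    _ ≤ A * ((if x.2 = i then 2 * ((d - 1 : ℕ) : ℝ) * (c 1 + c 0 + c (-1))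
          else c 2 + 2 * c 1 + 2 * c (-1) + c (-2) + 6 * ((d - 2 : ℕ) : ℝ) * c 0) * u x) + Λ * (T * u x) :=
        add_le_add (mul_le_mul_of_nonneg_left keyW hA) keyL
    _ ≤ A * (P * u x) + Λ * (T * u x) :=
        add_le_add (mul_le_mul_of_nonneg_left (mul_le_mul_of_nonneg_right hPi hux.le) hA) le_rfl
    _ = (A * P + Λ * T) * u x := by ring
    _ ≤ s * u x := mul_le_mul_of_nonneg_right hsup hux.le

/-- **The plain row** of a split matrix is `≤ s` under the same condition (`6(d−1) ≤ P(θ)`, `1 ≤ θ⁻¹^{2R+1}`). [folklore] -/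
theorem row_le_of_split (hd : 2 ≤ d) {nbr : ZdEdge d → Finset (ZdEdge d)} {C : ZdEdge d → ZdEdge d → ℝ} {A Λ : ℝ}
    (hA : 0 ≤ A) {L : ZdEdge d → ZdEdge d → ℝ} (hL0 : ∀ e y, 0 ≤ L e y)
    (hsplit : ∀ e, ∀ y ∈ nbr e, C e y ≤ A * linkInfluence e y + L e y) (hLrow : ∀ e, ∑ y ∈ nbr e, L e y ≤ Λ)
    {R : ℕ} {θ s : ℝ} (hθ0 : 0 < θ) (hθ1 : θ ≤ 1)
    (hsup : A * max (2 * ((d : ℝ) - 1) * (θ + θ⁻¹ + 1)) (θ⁻¹ ^ 2 + 2 * θ⁻¹ + 2 * θ + θ ^ 2 + 6 * ((d : ℝ) - 2)) +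
      Λ * θ⁻¹ ^ (2 * R + 1) ≤ s)
    (x : ZdEdge d) : ∑ z ∈ nbr x, C x z ≤ s := by
  classical
  have hd1 : 1 ≤ d := by omega
  have hd2 : (2 : ℝ) ≤ d := by exact_mod_cast hd
  have hΛ0 : 0 ≤ Λ := (Finset.sum_nonneg fun y _ => hL0 x y).trans (hLrow x)
  have hθθ : 2 ≤ θ + θ⁻¹ := by
    have e : θ + θ⁻¹ - 2 = (θ - 1) ^ 2 / θ := by field_simp; ring
    have : 0 ≤ (θ - 1) ^ 2 / θ := div_nonneg (sq_nonneg _) hθ0.le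
    linarith
  have hP : 6 * ((d : ℝ) - 1) ≤ max (2 * ((d : ℝ) - 1) * (θ + θ⁻¹ + 1)) (θ⁻¹ ^ 2 + 2 * θ⁻¹ + 2 * θ + θ ^ 2 + 6 * ((d : ℝ) - 2)) :=
    le_max_of_le_left (by nlinarith)
  have hT : (1 : ℝ) ≤ θ⁻¹ ^ (2 * R + 1) := one_le_pow₀ ((one_le_inv₀ hθ0).2 hθ1)
  have hn : ∑ z ∈ nbr x, (linkInfluence x z : ℝ) ≤ 6 * ((d : ℝ) - 1) := by
    have h := sum_linkInfluence_le_of_subset x (nbr x)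
    calc ∑ z ∈ nbr x, (linkInfluence x z : ℝ) = ((∑ z ∈ nbr x, linkInfluence x z : ℕ) : ℝ) := by push_cast; rfl
      _ ≤ ((6 * (d - 1) : ℕ) : ℝ) := by exact_mod_cast h
      _ = 6 * ((d : ℝ) - 1) := by push_cast [Nat.cast_sub hd1]; ring
  calc ∑ z ∈ nbr x, C x z ≤ ∑ z ∈ nbr x, (A * linkInfluence x z + L x z) := Finset.sum_le_sum fun z hz => hsplit x z hz
    _ = A * ∑ z ∈ nbr x, (linkInfluence x z : ℝ) + ∑ z ∈ nbr x, L x z := by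
        rw [Finset.mul_sum, ← Finset.sum_add_distrib]
    _ ≤ A * (6 * ((d : ℝ) - 1)) + Λ * 1 := by rw [mul_one]; exact add_le_add (mul_le_mul_of_nonneg_left hn hA) (hLrow x)
    _ ≤ _ := le_trans (add_le_add (mul_le_mul_of_nonneg_left hP hA) (mul_le_mul_of_nonneg_left hT hΛ0)) hsup

/-! ### The generic `ℓ∞` clustering bound -/

/-- **`ℓ∞`-SEPARATION CLUSTERING FROM A SPLIT DOBRUSHIN MATRIX (generic `ℤ^d` door, pairwise estimate).**  Let `γ` be a specification of
`SU(N)` link variables on `ℤ^d` (`d ≥ 2`) with a KR contraction `C` over `nbr` for the Frobenius weight, split as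
`C(e,y) ≤ A·linkInfluence e y + L(e,y)` with `A ≥ 0`, `L ≥ 0`, `Σ_{nbr e} L(e,·) ≤ Λ`, neighbourhoods of `ℓ∞`-range `≤ R`.  If `0 < θ ≤ 1` and `s < 1`
satisfy `A·max(2(d−1)(θ+θ⁻¹+1), θ⁻²+2θ⁻¹+2θ+θ²+6(d−2)) + Λθ⁻¹^{2R+1} ≤ s`, then every Gibbs measure `μ` of `γ` and all bounded measurable local
`f, g` (supports `Δ_f, Δ_g`, Frobenius-Lipschitz vectors `δ_f, δ_g`) whose supports are at `ℓ∞`-distance `≥ n` — `n ≤ ‖x − y‖∞` for all base points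
`x` of `Δ_f`, `y` of `Δ_g` — satisfy `|cov_μ(f,g)| ≤ (4N/(θ(1−s))) (Σδ_g)(Σδ_f) θ^{2n}`. [cite: Follmer1988, Ch. I Theorem (2.13)] -/
theorem abs_cov_le_linfty_of_split (hd : 2 ≤ d) {γ : Specification (ZdEdge d) (Matrix.specialUnitaryGroup (Fin N) ℂ)}
    (hγ : IsSpecification γ) {nbr : ZdEdge d → Finset (ZdEdge d)} {C : ZdEdge d → ZdEdge d → ℝ}
    (hKR : IsKRContraction γ suFrobDist nbr C) {A Λ : ℝ} (hA : 0 ≤ A) {L : ZdEdge d → ZdEdge d → ℝ}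
    (hL0 : ∀ e y, 0 ≤ L e y) (hsplit : ∀ e, ∀ y ∈ nbr e, C e y ≤ A * linkInfluence e y + L e y)
    (hLrow : ∀ e, ∑ y ∈ nbr e, L e y ≤ Λ) {R : ℕ} (hnbr : ∀ e, ∀ y ∈ nbr e, ‖e.1 - y.1‖ ≤ (R : ℝ))
    {θ s : ℝ} (hθ0 : 0 < θ) (hθ1 : θ ≤ 1) (hs1 : s < 1)
    (hsup : A * max (2 * ((d : ℝ) - 1) * (θ + θ⁻¹ + 1)) (θ⁻¹ ^ 2 + 2 * θ⁻¹ + 2 * θ + θ ^ 2 + 6 * ((d : ℝ) - 2)) +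
      Λ * θ⁻¹ ^ (2 * R + 1) ≤ s)
    {μ : Measure (LGConfig d (Matrix.specialUnitaryGroup (Fin N) ℂ))} (hμ : IsGibbsMeasure γ μ)
    {f g : LGConfig d (Matrix.specialUnitaryGroup (Fin N) ℂ) → ℝ} (hfm : Measurable f) {Δf : Finset (ZdEdge d)}
    (hfdep : DependsOn f (↑Δf : Set (ZdEdge d))) {Mf : ℝ} (hMf : ∀ σ, |f σ| ≤ Mf) {δf : ZdEdge d → ℝ}
    (hδf : IsLipBound suFrobDist f δf) (hgm : Measurable g) {Δg : Finset (ZdEdge d)}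
    (hgdep : DependsOn g (↑Δg : Set (ZdEdge d))) {Mg : ℝ} (hMg : ∀ σ, |g σ| ≤ Mg) {δg : ZdEdge d → ℝ}
    (hδg : IsLipBound suFrobDist g δg) (n : ℕ) (hdist : ∀ x ∈ Δf, ∀ y ∈ Δg, (n : ℝ) ≤ ‖x.1 - y.1‖) :
    |cov[f, g; μ]| ≤ 4 * N / (θ * (1 - s)) * (∑ y ∈ Δg, δg y) * (∑ x ∈ Δf, δf x) * θ ^ (2 * n) := by
  classical
  have hd0 : 0 < d := by omega
  -- rows `≤ s`, hence `0 ≤ s`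
  have hrow : ∀ x, ∑ z ∈ nbr x, C x z ≤ s := fun x => row_le_of_split hd hA hL0 hsplit hLrow hθ0 hθ1 hsup x
  have hs0 : 0 ≤ s := (Finset.sum_nonneg fun z _ => hKR.nonneg _ z).trans (hrow ((fun _ => 0), ⟨0, hd0⟩))
  -- the profile: minimum over the axes of the two-sided profile in the doubled coordinates
  have huniv : (Finset.univ : Finset (Fin d)).Nonempty := ⟨⟨0, hd0⟩, Finset.mem_univ _⟩
  set H : Fin d → ZdEdge d → ℤ := fun i z => 2 * z.1 i + (if z.2 = i then 1 else 0) with hH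
  set p : ZdEdge d → ZdEdge d → ℝ := fun x y => Finset.univ.inf' huniv fun i => θ ^ (H i x - H i y).natAbs with hp
  have hp0 : ∀ x y, 0 ≤ p x y := fun x y => (Finset.le_inf'_iff huniv _).2 fun i _ => pow_nonneg hθ0.le _
  have hpyy : ∀ y, p y y = 1 := fun y => by
    simp only [hp, sub_self, Int.natAbs_zero, pow_zero]
    exact Finset.inf'_const huniv 1
  have hpy : ∀ y, 0 < p y y := fun y => by rw [hpyy]; exact one_pos
  have hcol : ∀ (y x : ZdEdge d), ∑ z ∈ nbr x, C x z * p z y ≤ s * p x y := by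
    intro y x
    obtain ⟨i₀, -, hi₀⟩ := Finset.exists_mem_eq_inf' huniv (fun i => θ ^ (H i x - H i y).natAbs)
    have hpx : p x y = θ ^ (H i₀ x - H i₀ y).natAbs := hi₀
    calc ∑ z ∈ nbr x, C x z * p z y ≤ ∑ z ∈ nbr x, C x z * θ ^ (H i₀ z - H i₀ y).natAbs :=
          Finset.sum_le_sum fun z _ => mul_le_mul_of_nonneg_left (Finset.inf'_le _ (Finset.mem_univ i₀)) (hKR.nonneg x z)
      _ ≤ s * θ ^ (H i₀ x - H i₀ y).natAbs := column_le_of_split hd hA hL0 hsplit hLrow hnbr hθ0 hθ1 hsup x i₀ (H i₀ y)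
      _ = s * p x y := by rw [hpx]
  -- the pair profile bound from the `ℓ∞` distance
  have hpt : ∀ x ∈ Δf, ∀ y ∈ Δg, p x y / p y y ≤ θ⁻¹ * (θ ^ 2) ^ n := by
    intro x hx y hy
    rw [hpyy, div_one]
    rcases Nat.eq_zero_or_pos n with hn | hn
    · subst hn
      rw [pow_zero, mul_one]
      refine le_trans ?_ ((one_le_inv₀ hθ0).2 hθ1)
      exact (Finset.inf'_le _ (Finset.mem_univ (⟨0, hd0⟩ : Fin d))).trans (pow_le_one₀ hθ0.le hθ1)
    · obtain ⟨i, hi⟩ := exists_le_natAbs_hc_sub (by omega) (hdist x hx y hy)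
      refine (Finset.inf'_le _ (Finset.mem_univ i)).trans ?_
      refine (pow_le_pow_of_le_one hθ0.le hθ1 hi).trans ?_
      exact pow_two_mul_sub_one_le' hθ0 hθ1 n
  -- Föllmer's pairwise estimate
  have key := abs_covariance_le_of_pair_profile hγ hKR (r := suFrobDist) (R := 2 * Real.sqrt N) suFrobDist_nonneg
    suFrobDist_le (by positivity) hs0 hs1 hrow hμ hfm hfdep hMf hδf hgm hgdep hMg hδg hs1 hp0 (fun y _ => hpy y)
    (fun y _ x => hcol y x) (B := θ⁻¹) (t := (θ ^ 2) ^ n) (fun x hx y hy => hpt x hx y hy)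
  refine key.trans (le_of_eq ?_)
  have hN4 : (2 * Real.sqrt (N : ℝ)) ^ 2 = 4 * N := by rw [mul_pow, Real.sq_sqrt (by positivity)]; norm_num
  rw [hN4, ← pow_mul]
  have h1s : (1 - s) ≠ 0 := by linarith
  field_simp

/-- The `setDistEdges` form of the separation hypothesis: `n ≤ setDistEdges Δ_f Δ_g` gives `n ≤ ‖x − y‖∞` for every pair. [folklore] -/
theorem forall_le_norm_of_le_setDistEdges {Δf Δg : Finset (ZdEdge d)} {D : ℝ} (h : D ≤ setDistEdges Δf Δg) :
    ∀ x ∈ Δf, ∀ y ∈ Δg, D ≤ ‖x.1 - y.1‖ := fun _ hx _ hy => h.trans (setDistEdges_le_norm_sub hx hy)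

end Summit.Ventures.YMGap.RobustBall.ZdAxis

end
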